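import Summits.BirchSwinnertonDyer.BirchSwinnertonDyer.Theorems.ErratumRoadFiveNonSurjCornerTwinTateParameterPow
import Literature.NumberTheory.EllipticCurves.NeronOggShafarevichLocal
import Literature.NumberTheory.EllipticCurves.PAdicHeightsProofs
import Mathlib.RepresentationTheory.Maschke
import HarnessLib

/-!
# Crux `PrintX11a.UpperNonSurjFive` (U5, stmt-BirchSwinnertonDyer-20614) — NEGATIVE lane: the tame
# Mazur–Tate instrument is VACUOUS on U5 — on `Irr ∧ ¬Surj` the Tate parameter `q_ℓ` is a `p`-th power in
# `ℚ_ℓ` at EVERY multiplicative prime `ℓ` (`ℓ = p` allowed, no congruence), so its unit residue `ū_ℓ ∈ 𝔽_ℓˣ`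
# is a `p`-th power (cell `bsd-print-x11a`, referee g28; `--supports stmt-BirchSwinnertonDyer-20614`; closes nothing)

WHAT. bsd-idea-6 g29's barrier memo (BARRIER-tameMT-trivial-carriers-g29 §F3) typed
`Cruxes/UpperNonSurjFive/TameInstrumentVacuous.lean ∷ TameMT.TameInstrumentVacuous`: on U5, at a split
multiplicative `ℓ ≠ p`, `ℓ ≡ 1 (mod p)`, the residue `ū_ℓ` of the unit part of `q_ℓ` is a `p`-th power in
`𝔽_ℓˣ` (so the tame Mazur–Tate identity `λ_R(ū_ℓ)·[0] = ord_ℓ(q_ℓ)·θ'_{E,ℓ}` has left side `≡ 0 (mod p)` and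
cannot pay Tamagawa depth). This file PROVES it, without `5 ≤ p`, `ℓ ≠ p`, `ℓ ≡ 1 (mod p)` or `p ≠ 2`:
§0 `exists_stable_line_compl` — MASCHKE on `E[p](ℚ̄)` (Mathlib `RepresentationTheory.Maschke`): if
`p ∤ #ρ̄_{E,p}(Γ_ℚ)` then along any `ψ : Γ' → Γ_ℚ` every `ψ`-stable line has a `ψ`-stable complement;
§1 `exists_pow_eq_tateParameter_of_multAt_of_not_dvd_card` — at ANY multiplicative place `v`,
`p ∤ #ρ̄(Γ_ℚ)` ⇒ the Tate parameter `q ∈ (ℚ_v^×)^p` (the line `φ(μ_p) ≤ E_q[p]` pulls back along the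
sign-equivariant `E(ℚ̄) → E_q(ℚ̄_v)` of `CornerLocal.exists_signEquiv_tateCurve`; §0 gives a second stable
line; [GenEll] Lemma 3.2 (i) = `GenEll_lemma32_i` concludes) — subsumes the `v = p` corner theorem
`CornerLocal.exists_pow_eq_tateParameter_of_mult_of_not_dvd_card` with an inertia-free proof at every `ℓ`;
§2 `exists_pow_eq_tateParameterData_q_of_not_dvd_card ∕ _of_irr_of_not_surj ∕ _of_classX11a_of_not_surj` —
transport to `D : TateParameterData W ℓ` along `adicCompletion.padicEquiv` (as in `TatePow`), `p ∤ #ρ̄(Γ_ℚ)`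
from `Irr ∧ ¬Surj` by Serre's Prop. 15 (`not_dvd_card_of_not_hasSurjectiveModNGaloisRep`); §2b
`dvd_padicValInt_minimalDiscriminantInt_of_classX11a_of_not_surj` — `p ∣ ord_ℓ(q_ℓ) = ord_ℓ(Δ_min)` at every
split multiplicative `ℓ` of a U5 cell (table-checkable; kit PARI job `j337110`: 89/89 census rows); §3
`exists_unitCoeff_eq_pow_of_pow_eq` (pure `ℤ_ℓ`: the unit part of an `n`-th power is an `n`-th power) and
`tameInstrumentVacuous_unfolded` = `TameMT.TameInstrumentVacuous` with its binder list VERBATIM (side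
conditions carried but UNUSED) and `qInt`/`tateUnitResidue` unfolded to any `x : ℤ_[ℓ]`, `x ≠ 0`, `↑x = D.q`
(Theorems files do not import Cruxes files; the Cruxes statement follows by
`… D (TameMT.qInt D) (TameMT.qInt_ne_zero D) rfl`, checked in the referee's scratch PIN);
`not_exists_tame_antecedents` is the `¬ ∃` (negative-knowledge) form.
HONEST FRAMING: negative lane of U5 — structure theorems about the local curves `E/ℚ_ℓ` of a non-surjective
irreducible pair, showing that an instrument (the tame Mazur–Tate regulator entry at a Tate prime) carries no
information on U5. Nothing here proves U5, a stub of line `gl1cartan5`, the route target, or BSD for any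
curve; PARTITION count unchanged (0 leaves); beyond-print theorem: no (Serre 1972 Prop. 15 + Tate's `E_q[p]`,
ATAEC V.6.1, read through Maschke). Tame twin of `Theorems/UpperNonSurjFive/Negative/GSDepthInstrumentVacuous`.
References: [Serre1972] §2.4 Prop. 15, §1.12; [SilvermanATAEC1994] Lemma V.5.2 (c), Thm. V.5.3, Prop. V.6.1
(PDF pp. 405–412); [MochizukiGenEll2010] §3 Lemma 3.2 (i); [MazurTate1987] §1.
-/

set_option linter.dupNamespace false -- `Summit.BirchSwinnertonDyer.BirchSwinnertonDyer` (summit = problem), tree-wide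
set_option autoImplicit false

noncomputable section

open scoped Classical NumberField
open IsDedekindDomain Field WeierstrassCurve NumberField Rat.HeightOneSpectrum
  Literature.NumberTheory.EllipticCurves Literature.NumberTheory.EllipticCurves.TateCurve
  Literature.NumberTheory.GaloisRepresentations SteinWuthrich2013
  Literature.NumberTheory.EllipticCurves.Rank1Residual Summit.BirchSwinnertonDyer.Rank1Residual

namespace Summit.BirchSwinnertonDyer.BirchSwinnertonDyer.Theorems.UpperNonSurjFive.Negative

variable (W : WeierstrassCurve ℚ) [W.IsElliptic] (p : ℕ) [hp : Fact p.Prime]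

/-! ### §0. Maschke on `E[p]`: a stable line has a stable complement when `p ∤ #ρ̄(Γ_ℚ)` -/
/-- **Maschke on the `𝔽_p`-plane `E[p](ℚ̄)`.** If `p ∤ #ρ̄_{E,p}(Γ_ℚ)` and `ψ : Γ' → Γ_ℚ` is any hom
(e.g. from a decomposition group), every `Γ'`-stable line `L₀ ≤ E[p]` (`#L₀ = p`) has a `Γ'`-stable line
`L₁` with `L₀ ∩ L₁ = 0`: `H = ρ̄(ψ(Γ'))` is finite of order prime to `p`, so the `𝔽_p[H]`-module `E[p]` is
semisimple (Mathlib `IsSemisimpleRepresentation`) and `L₀` has an `H`-stable complement of order `p`. [folklore] -/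
theorem exists_stable_line_compl {Γ' : Type*} [Group Γ'] (ψ : Γ' →* absoluteGaloisGroup ℚ)
    (hG : ¬ p ∣ Nat.card (galoisRepTorsion W p).range)
    (L₀ : AddSubgroup (geomTorsion W p)) (h₀ : Nat.card L₀ = p)
    (hstab : ∀ σ : Γ', ∀ x ∈ L₀, ψ σ • x ∈ L₀) :
    ∃ L₁ : AddSubgroup (geomTorsion W p), Nat.card L₁ = p ∧ (∀ x, x ∈ L₀ → x ∈ L₁ → x = 0) ∧
      ∀ σ : Γ', ∀ x ∈ L₁, ψ σ • x ∈ L₁ := by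
  have hpp : p.Prime := hp.out
  letI : Module (ZMod p) (geomTorsion W p) := AddSubgroup.torsionBy.zmodModule
  have hp0 : ((p : ℕ) : ℤ) ≠ 0 := by exact_mod_cast hpp.ne_zero
  haveI : Finite (geomTorsion W p) := finite_torsionPoints_holds W (AlgebraicClosure ℚ) hp0
  haveI : Finite (AddAut (geomTorsion W p)) := Finite.of_injective _ AddEquiv.toEquiv_injective
  haveI : Finite (Multiplicative (AddAut (geomTorsion W p))) := Finite.of_equiv _ Multiplicative.ofAdd
  have hcard : Nat.card (geomTorsion W p) = p ^ 2 :=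
    card_torsionPoints_eq_sq_holds W (AlgebraicClosure ℚ) (n := p) (by exact_mod_cast hpp.ne_zero)
  -- the finite group `H = ρ̄(ψ(Γ'))` has order prime to `p`
  set H : Subgroup (Multiplicative (AddAut (geomTorsion W p))) :=
    ((galoisRepTorsion W p).comp ψ).range with hH
  have hHle : H ≤ (galoisRepTorsion W p).range := by
    rintro _ ⟨σ, rfl⟩
    exact ⟨ψ σ, rfl⟩
  have hHcard : ¬ p ∣ Nat.card H := fun h ↦ hG (h.trans (Subgroup.card_dvd_of_le hHle))
  haveI : NeZero (Nat.card H : ZMod p) := ⟨by rwa [Ne, ZMod.natCast_eq_zero_iff]⟩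
  -- the representation of `H` on `E[p]`
  let ρ : Representation (ZMod p) H (geomTorsion W p) :=
    { toFun := fun h ↦
        (Multiplicative.toAdd (h : Multiplicative (AddAut (geomTorsion W p)))).toAddMonoidHom.toZModLinearMap p
      map_one' := by ext x; rfl
      map_mul' := fun g h ↦ by ext x; rfl }
  have hρ : ∀ (σ : Γ') (x : geomTorsion W p),
      ρ ⟨(galoisRepTorsion W p).comp ψ σ, σ, rfl⟩ x = ψ σ • x := fun _ _ ↦ rfl
  -- `L₀` as a subrepresentation, and a complement (Maschke)
  let L₀' : Subrepresentation ρ :=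
    ⟨AddSubgroup.toZModSubmodule p L₀, by
      rintro ⟨_, σ, rfl⟩ x hx
      rw [AddSubgroup.mem_toZModSubmodule] at hx ⊢
      rw [hρ]
      exact hstab σ x hx⟩
  obtain ⟨L₁', hc⟩ := exists_isCompl L₀'
  have hbot : ∀ x, x ∈ L₀ → x ∈ L₁'.toSubmodule → x = 0 := by
    intro x hx₀ hx₁
    have hx : x ∈ (L₀' ⊓ L₁').toSubmodule := Submodule.mem_inf.mpr ⟨hx₀, hx₁⟩
    rw [hc.inf_eq_bot] at hx
    exact (Submodule.mem_bot (ZMod p)).mp hx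
  have hc' : IsCompl L₀'.toSubmodule L₁'.toSubmodule := by
    refine ⟨disjoint_iff.mpr ?_, codisjoint_iff.mpr ?_⟩
    · change (L₀' ⊓ L₁').toSubmodule = (⊥ : Subrepresentation ρ).toSubmodule
      rw [hc.inf_eq_bot]
    · change (L₀' ⊔ L₁').toSubmodule = (⊤ : Subrepresentation ρ).toSubmodule
      rw [hc.sup_eq_top]
  have h₀' : Nat.card L₀'.toSubmodule = p := h₀
  have h₁ : Nat.card L₁'.toSubmodule = p := by
    have h := Nat.card_congr (Submodule.prodEquivOfIsCompl _ _ hc').toEquiv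
    rw [Nat.card_prod, h₀', hcard, sq] at h
    exact Nat.eq_of_mul_eq_mul_left hpp.pos h
  refine ⟨L₁'.toSubmodule.toAddSubgroup, h₁, fun x hx₀ hx₁ ↦ hbot x hx₀ hx₁, ?_⟩
  intro σ x hx
  have := L₁'.apply_mem_toSubmodule ⟨(galoisRepTorsion W p).comp ψ σ, σ, rfl⟩ hx
  rwa [hρ] at this

/-! ### §1. At every multiplicative place the Tate parameter is a `p`-th power when `p ∤ #ρ̄(Γ_ℚ)` -/
/-- **THE TATE PARAMETER AT ANY MULTIPLICATIVE PLACE IS A `p`-TH POWER when `p ∤ #ρ̄_{E,p}(Γ_ℚ)`**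
(`v` ANY place of multiplicative reduction, `ℓ = p` and `p = 2` allowed; `q ∈ ℚ_v`, `q ≠ 0`, `‖q‖ < 1`,
`j(E_q) = j(W)` ⇒ `q = r^p`). Proof: `M = φ(μ_p) ≤ E_q[p]` is a `Γ_{ℚ_v}`-stable line
(`exists_stable_subgroup_card_eq`); along the injective SIGN-equivariant `f : E[p](ℚ̄) → E_q(ℚ̄_v)`
(ATAEC V.5.3 (a) + V.5.2 (c), `CornerLocal.exists_signEquiv_tateCurve`; `E_q[p] ⊆ im f`, AEC III.6.4 (b))
`L₀ = f⁻¹(M)` is a stable line of `E[p](ℚ̄)`; MASCHKE (§0) gives a stable complement `L₁`, whose image is a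
second stable line of order `p` in `E_q(ℚ̄_v)`; [GenEll] Lemma 3.2 (i) (`GenEll_lemma32_i`) forces
`q ∈ (ℚ_v^×)^p` — i.e. the Kummer class of `q` in `ℚ_v^×/p` vanishes, `0 → μ_p → E_q[p] → ℤ/p → 0` splits.
[cite: SilvermanATAEC1994, Lemma V.5.2 (c), Thm. V.5.3, Prop. V.6.1 (PDF pp. 405–412)]
[cite: MochizukiGenEll2010, §3 Lemma 3.2 (i)] [cite: Serre1972, §2.4 Prop. 15] -/
theorem exists_pow_eq_tateParameter_of_multAt_of_not_dvd_card
    (hG : ¬ p ∣ Nat.card (galoisRepTorsion W p).range)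
    {v : HeightOneSpectrum (𝓞 ℚ)} (hmultv : W.HasMultiplicativeReductionAt v)
    {q : v.adicCompletion ℚ} (hq0 : q ≠ 0) (hq : ‖q‖ < 1)
    (hqj : tateJ q = (W.baseChange (v.adicCompletion ℚ)).j) :
    ∃ r : v.adicCompletion ℚ, r ^ p = q := by
  have hpp : p.Prime := hp.out
  -- NB: no `CharZero ℚ_v` instance in scope (it would let `DivisionRing.toRatAlgebra` compete with
  -- `instAlgebraAdicCompletion` for `Algebra ℚ ℚ_v`); it is passed explicitly where needed.
  letI := Literature.NumberTheory.GaloisRepresentations.Ultrametric.AdicCompletion.nontriviallyNormedField ℚ v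
  -- V.5.3 (a) + V.5.2 (c): the sign-equivariant `e : W(ℚ̄_v) ≃+ E_q(ℚ̄_v)`
  obtain ⟨t, e, hsign⟩ := CornerLocal.exists_signEquiv_tateCurve W hmultv hq0 hq hqj
  set ι := closureEmb (K := ℚ) (v.adicCompletion ℚ) with hι
  -- the transport `f = e ∘ ι_* : E[p](ℚ̄) → E_q(ℚ̄_v)`, injective, sign-equivariant
  set f : geomTorsion W p →+ geomPoints (tateCurve q) :=
    e.toAddMonoidHom.comp ((pointsMapOfEmb W ι).comp (geomTorsion W (p : ℤ)).subtype) with hf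
  have hfapply : ∀ x : geomTorsion W p, f x = e (pointsMapOfEmb W ι (x : geomPoints W)) := fun _ ↦ rfl
  have hfinj : Function.Injective f := by
    intro x y hxy
    rw [hfapply, hfapply] at hxy
    exact Subtype.ext (pointsMapOfEmb_injective W ι (e.injective hxy))
  have hfsmul : ∀ (σ : absoluteGaloisGroup (v.adicCompletion ℚ)) (x : geomTorsion W p),
      σ • f x = (if absoluteGaloisGroup.toAlgEquiv _ σ t = t then (1 : ℤ) else -1) •
        f (resGalOfEmb ι σ • x) := by
    intro σ x
    rw [hfapply, hfapply, hsign σ, AddSubgroup.torsionBy.coe_smul, pointsMapOfEmb_smul]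
  have hss : ∀ (σ : absoluteGaloisGroup (v.adicCompletion ℚ)) (y : geomPoints (tateCurve q)),
      (if absoluteGaloisGroup.toAlgEquiv _ σ t = t then (1 : ℤ) else -1) •
        ((if absoluteGaloisGroup.toAlgEquiv _ σ t = t then (1 : ℤ) else -1) • y) = y := by
    intro σ y
    split_ifs <;> simp
  -- images of `Γ_{ℚ_v}`-stable subgroups are `Γ_{ℚ_v}`-stable (a sign does not move a subgroup)
  have hN : ∀ L : AddSubgroup (geomTorsion W p),
      (∀ σ : absoluteGaloisGroup (v.adicCompletion ℚ), ∀ x ∈ L, resGalOfEmb ι σ • x ∈ L) →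
      ∀ σ : absoluteGaloisGroup (v.adicCompletion ℚ), ∀ z ∈ L.map f, σ • z ∈ L.map f := by
    intro L hL σ z hz
    obtain ⟨x, hx, rfl⟩ := AddSubgroup.mem_map.mp hz
    rw [hfsmul]
    exact AddSubgroup.zsmul_mem _ (AddSubgroup.mem_map_of_mem f (hL σ x hx)) _
  -- the `Γ_{ℚ_v}`-stable line `M = φ(μ_p) ≤ E_q(ℚ̄_v)` of order `p`
  obtain ⟨M, hM, hMstab⟩ := @exists_stable_subgroup_card_eq (v.adicCompletion ℚ) _ _ _
    (charZero_adicCompletion' ℚ v) q hq0 hq p hpp.pos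
  -- [GenEll] Lemma 3.2 (i): either `q` is a `p`-th power, or `M` is the unique stable line
  rcases @GenEll_lemma32_i (v.adicCompletion ℚ) _ _ _ (charZero_adicCompletion' ℚ v) q hq0 hq p hpp
      M hM hMstab with h | huniq
  · exact h
  exfalso
  -- `M ⊆ f(E[p](ℚ̄))`: every point of `E_q(ℚ̄_v)` killed by `p` comes from `E[p](ℚ̄)` (AEC III.6.4 (b))
  have hMle : M ≤ f.range := by
    intro z hz
    have hpz : p • z = 0 := by
      have h := card_nsmul_eq_zero' (x := (⟨z, hz⟩ : M))
      rw [hM] at h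
      simpa using congrArg Subtype.val h
    have hQ : p • e.symm z = 0 := by rw [← map_nsmul, hpz, map_zero]
    obtain ⟨P, hP, hPz⟩ := exists_pointsMapOfEmb_eq_of_nsmul_eq_zero W ι hpp.ne_zero hQ
    refine ⟨⟨P, (Submodule.mem_torsionBy_iff _ _).mpr <| by rw [natCast_zsmul, hP]⟩, ?_⟩
    rw [hfapply]
    change e (pointsMapOfEmb W ι P) = z
    rw [hPz, e.apply_symm_apply]
  -- its preimage `L₀ = f⁻¹(M)` is a `Γ_{ℚ_v}`-stable line of `E[p](ℚ̄)`
  set L₀ : AddSubgroup (geomTorsion W p) := M.comap f with hL₀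
  have hL₀map : L₀.map f = M := by rw [hL₀, AddSubgroup.map_comap_eq, inf_eq_right.mpr hMle]
  have h₀ : Nat.card L₀ = p := by
    have h := AddSubgroup.card_map_of_injective (K := L₀) hfinj
    rw [hL₀map, hM] at h
    exact h.symm
  have hL₀stab : ∀ σ : absoluteGaloisGroup (v.adicCompletion ℚ), ∀ x ∈ L₀, resGalOfEmb ι σ • x ∈ L₀ := by
    intro σ x hx
    rw [hL₀, AddSubgroup.mem_comap] at hx ⊢
    have h1 : f (resGalOfEmb ι σ • x) =
        (if absoluteGaloisGroup.toAlgEquiv _ σ t = t then (1 : ℤ) else -1) • (σ • f x) := by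
      rw [hfsmul, hss]
    rw [h1]
    exact AddSubgroup.zsmul_mem _ (hMstab σ _ hx) _
  -- MASCHKE (§0): a `Γ_{ℚ_v}`-stable complement `L₁`
  obtain ⟨L₁, h₁, hinf, hL₁stab⟩ :=
    exists_stable_line_compl W p (resGalOfEmb ι).toMonoidHom hG L₀ h₀ hL₀stab
  -- its image is a second stable subgroup of order `p` of `E_q(ℚ̄_v)`, hence `= M`; so `L₁ ≤ L₀`, `L₁ = 0`
  have hN₁ : Nat.card (L₁.map f) = p := by rw [AddSubgroup.card_map_of_injective hfinj, h₁]
  have hEq : L₁.map f = M := huniq _ hN₁ (hN L₁ hL₁stab)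
  have hL₁bot : L₁ = ⊥ := by
    refine (AddSubgroup.eq_bot_iff_forall _).mpr fun x hx ↦ hinf x ?_ hx
    rw [hL₀, AddSubgroup.mem_comap, ← hEq]
    exact AddSubgroup.mem_map_of_mem f hx
  rw [hL₁bot, AddSubgroup.card_bot] at h₁
  exact hpp.one_lt.ne h₁

/-- **Corollary (the `v = p` case, `p` arbitrary)**: `CornerLocal.exists_pow_eq_tateParameter_of_mult_of_not_dvd_card`
WITHOUT its hypothesis `p ≠ 2` — `Mult W p`, `p ∤ #ρ̄_{E,p}(Γ_ℚ)`, `v` the place of `p`, `q ∈ ℚ_v` the Tate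
parameter ⇒ `q ∈ (ℚ_v^×)^p`. [cite: SilvermanATAEC1994, Thm. V.5.3] [cite: MochizukiGenEll2010, §3 Lemma 3.2 (i)] -/
theorem exists_pow_eq_tateParameter_of_mult_of_not_dvd_card' (hmult : Mult W p)
    (hG : ¬ p ∣ Nat.card (galoisRepTorsion W p).range)
    {v : HeightOneSpectrum (𝓞 ℚ)} (hv : (primesEquiv v : ℕ) = p)
    {q : v.adicCompletion ℚ} (hq0 : q ≠ 0) (hq : ‖q‖ < 1)
    (hqj : tateJ q = (W.baseChange (v.adicCompletion ℚ)).j) :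
    ∃ r : v.adicCompletion ℚ, r ^ p = q :=
  exists_pow_eq_tateParameter_of_multAt_of_not_dvd_card W p hG
    (CornerLocal.hasMultiplicativeReductionAt_of_mult W p hmult hv) hq0 hq hqj

/-! ### §2. The `ℚ_[ℓ]`-datum `D : TateParameterData W ℓ` is a `p`-th power, at every Tate prime `ℓ` -/
/-- **`D.q ∈ (ℚ_ℓ^×)^p` for every Tate datum at every split multiplicative prime `ℓ`** when
`p ∤ #ρ̄_{E,p}(Γ_ℚ)`: §1 at the place `v` of `ℓ` (multiplicative there by `D.split`), transported along
Mathlib's `e = adicCompletion.padicEquiv v : ℚ_v ≃A[ℚ] ℚ_[ℓ]` exactly as in `TatePow` (`‖e⁻¹ q‖ < 1`,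
`j(e⁻¹ q) = j(W)` by `map_tateJ`). [cite: SilvermanATAEC1994, Thm. V.3.1 (b),(d), Thm. V.5.3]
[cite: MochizukiGenEll2010, §3 Lemma 3.2 (i)] -/
theorem exists_pow_eq_tateParameterData_q_of_not_dvd_card
    (hG : ¬ p ∣ Nat.card (galoisRepTorsion W p).range)
    (ℓ : ℕ) [hℓ : Fact ℓ.Prime] (D : TateParameterData W ℓ) : ∃ r : ℚ_[ℓ], r ^ p = D.q := by
  -- make `ℓ` literally `primesEquiv v`
  obtain ⟨v, hv⟩ := (primesEquiv (R := 𝓞 ℚ)).surjective ⟨ℓ, hℓ.out⟩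
  have hvℓ : ((primesEquiv v : Nat.Primes) : ℕ) = ℓ := congrArg Subtype.val hv
  subst hvℓ
  set e := adicCompletion.padicEquiv (R := 𝓞 ℚ) v with he
  set q' : v.adicCompletion ℚ := e.symm D.q with hq'
  have hq'0 : q' ≠ 0 := by rw [hq']; exact (map_ne_zero _).mpr D.q_ne_zero
  have hq'n : ‖q'‖ < 1 := (TatePow.norm_padicEquiv_symm_lt_one_iff v D.q).mpr D.norm_q_lt_one
  -- `j(q') = j(W)` in `ℚ_v`
  have hqj' : tateJ q' = (W.baseChange (v.adicCompletion ℚ)).j := by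
    have hmap := map_tateJ (e.symm : ℚ_[primesEquiv v] →+* v.adicCompletion ℚ) e.symm.continuous D.norm_q_lt_one
    rw [hq']
    change tateJ ((e.symm : ℚ_[primesEquiv v] →+* v.adicCompletion ℚ) D.q) = _
    rw [← hmap, D.tateJ_eq]
    change e.symm (algebraMap ℚ ℚ_[primesEquiv v] W.j) = (W.map (algebraMap ℚ (v.adicCompletion ℚ))).j
    rw [WeierstrassCurve.map_j]
    exact e.symm.toAlgEquiv.commutes W.j
  have hmultv : W.HasMultiplicativeReductionAt v :=
    CornerLocal.hasMultiplicativeReductionAt_of_mult W (primesEquiv v : ℕ)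
      D.split.hasMultiplicativeReductionAtPrime rfl
  obtain ⟨r', hr'⟩ :=
    exists_pow_eq_tateParameter_of_multAt_of_not_dvd_card W p hG hmultv hq'0 hq'n hqj'
  refine ⟨e r', ?_⟩
  rw [← map_pow, hr', hq', ContinuousAlgEquiv.apply_symm_apply]

/-- **`E[p]` irreducible and `ρ̄_{E,p}` NOT onto ⇒ at every split multiplicative `ℓ` the Tate datum is a
`p`-th power in `ℚ_ℓ`** (`p ∤ #ρ̄(Γ_ℚ)` by Serre's Prop. 15: otherwise the image is Borel or contains
`SL₂(𝔽_p)`). No parity, congruence or rank hypothesis. [cite: Serre1972, §2.4 Prop. 15]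
[cite: SilvermanATAEC1994, Thm. V.5.3] -/
theorem exists_pow_eq_tateParameterData_q_of_irr_of_not_surj (hirr : Irr W p) (hns : ¬ Surj W p)
    (ℓ : ℕ) [Fact ℓ.Prime] (D : TateParameterData W ℓ) : ∃ r : ℚ_[ℓ], r ^ p = D.q := by
  obtain ⟨e, Φ, he, -⟩ := exists_frame_galoisRepTorsion_rat W p
  have hG : ¬ p ∣ Nat.card (galoisRepTorsion W p).range := by
    rw [← card_map_range_galoisRepTorsion W p Φ]
    exact not_dvd_card_of_not_hasSurjectiveModNGaloisRep W p Φ e he hirr hns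
  exact exists_pow_eq_tateParameterData_q_of_not_dvd_card W p hG ℓ D

/-- **On U5's cells** (`ClassX11a W p ∧ ¬ Surj W p`; the binder `5 ≤ p` is not needed): at every split
multiplicative `ℓ` the Tate datum is a `p`-th power in `ℚ_ℓ`. [cite: Serre1972, §2.4 Prop. 15]
[cite: SilvermanATAEC1994, Thm. V.5.3] -/
theorem exists_pow_eq_tateParameterData_q_of_classX11a_of_not_surj [W.IsGloballyMinimal]
    (hX : ClassX11a W p) (hns : ¬ Surj W p) (ℓ : ℕ) [Fact ℓ.Prime] (D : TateParameterData W ℓ) :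
    ∃ r : ℚ_[ℓ], r ^ p = D.q :=
  exists_pow_eq_tateParameterData_q_of_irr_of_not_surj W p hX.2.2.2.1 hns ℓ D

/-- **`p ∣ ord_ℓ(q_ℓ)` on `Irr ∧ ¬Surj`**, at every split multiplicative `ℓ` (the valuation of a `p`-th power;
[GenEll] Lemma 3.2 (i) «`v_K(q_E) ∈ l·ℤ`», Serre's «`p ∣ v_ℓ(j)`»). [cite: MochizukiGenEll2010, §3 Lemma 3.2 (i)]
[cite: Serre1972, §2.4 Prop. 15] -/
theorem dvd_valuation_tateParameterData_q_of_irr_of_not_surj (hirr : Irr W p) (hns : ¬ Surj W p)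
    (ℓ : ℕ) [Fact ℓ.Prime] (D : TateParameterData W ℓ) : (p : ℤ) ∣ D.q.valuation := by
  obtain ⟨r, hr⟩ := exists_pow_eq_tateParameterData_q_of_irr_of_not_surj W p hirr hns ℓ D
  exact ⟨r.valuation, by rw [← hr, Padic.valuation_pow]⟩

/-- **`p ∣ ord_ℓ(Δ_min)` at every SPLIT multiplicative prime `ℓ` of a U5 cell** (`ClassX11a W p ∧ ¬ Surj W p`,
`W` globally minimal): a Tate datum exists at `ℓ` (ATAEC V.5.3, the tree's `nonempty_tateParameterData_iff`),
`ord_ℓ q_ℓ = ord_ℓ Δ_min` (`valuation_q_eq_padicValInt`), and `p ∣ ord_ℓ q_ℓ`. Table-checkable: PARI kit job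
`j337110` (referee g28) — all 89 (pair, multiplicative `ℓ`) rows of the 62 known U5 pairs have `p ∣ ord_ℓ Δ_min`
and unit part of `q_ℓ` in `(ℤ_ℓˣ)^p`; the surjective control `37a1`, `p = 5`, fails at `ℓ = 37` (`ord Δ = 1`).
[cite: SilvermanATAEC1994, Thm. V.3.1 (b), Thm. V.5.3] [cite: Serre1972, §2.4 Prop. 15] -/
theorem dvd_padicValInt_minimalDiscriminantInt_of_classX11a_of_not_surj [W.IsGloballyMinimal]
    (hX : ClassX11a W p) (hns : ¬ Surj W p) (ℓ : ℕ) [Fact ℓ.Prime]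
    (hsplit : W.HasSplitMultiplicativeReductionAtPrime ℓ) : p ∣ padicValInt ℓ W.minimalDiscriminantInt := by
  obtain ⟨D⟩ := (nonempty_tateParameterData_iff_holds W ℓ).2 hsplit
  have h : (p : ℤ) ∣ (padicValInt ℓ W.minimalDiscriminantInt : ℤ) := by
    rw [← TateParameterData.valuation_q_eq_padicValInt_holds (W := W) (p := ℓ) D]
    exact dvd_valuation_tateParameterData_q_of_irr_of_not_surj W p hX.2.2.2.1 hns ℓ D
  exact Int.natCast_dvd_natCast.mp h

/-! ### §3. The unit residue `ū_ℓ ∈ 𝔽_ℓˣ` of the Tate period is a `p`-th power -/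
/-- **Pure `ℤ_ℓ`-algebra: the unit part of an `n`-th power is an `n`-th power.** If `x ∈ ℤ_ℓ ∖ 0` and
`x = r^n` with `r ∈ ℚ_ℓ`, `0 < n`, then `r ∈ ℤ_ℓ` and `u_x = u_r^n` for Mathlib's unit parts
(`PadicInt.unitCoeff`, `x = u_x · ℓ^{v(x)}` uniquely). [folklore] -/
theorem exists_unitCoeff_eq_pow_of_pow_eq {ℓ : ℕ} [hℓ : Fact ℓ.Prime] {x : ℤ_[ℓ]} (hx : x ≠ 0)
    {n : ℕ} (hn : 0 < n) {r : ℚ_[ℓ]} (hr : r ^ n = x) :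
    ∃ u : ℤ_[ℓ]ˣ, PadicInt.unitCoeff hx = u ^ n := by
  have hr1 : ‖r‖ ≤ 1 := by
    have h : ‖r‖ ^ n ≤ 1 := by rw [← norm_pow, hr]; exact x.2
    exact (pow_le_one_iff_of_nonneg (norm_nonneg r) hn.ne').mp h
  set R : ℤ_[ℓ] := ⟨r, hr1⟩ with hRdef
  have hRn : R ^ n = x := PadicInt.ext (by rw [PadicInt.coe_pow]; exact hr)
  have hR0 : R ≠ 0 := by
    rintro h0
    rw [h0, zero_pow hn.ne'] at hRn
    exact hx hRn.symm
  refine ⟨PadicInt.unitCoeff hR0, ?_⟩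
  have hval : x.valuation = n * R.valuation := by rw [← hRn, PadicInt.valuation_pow]
  have hℓ0 : (ℓ : ℤ_[ℓ]) ^ x.valuation ≠ 0 := pow_ne_zero _ (by exact_mod_cast hℓ.out.ne_zero)
  have key : (PadicInt.unitCoeff hx : ℤ_[ℓ]) * (ℓ : ℤ_[ℓ]) ^ x.valuation =
      ((PadicInt.unitCoeff hR0 ^ n : ℤ_[ℓ]ˣ) : ℤ_[ℓ]) * (ℓ : ℤ_[ℓ]) ^ x.valuation := by
    rw [← PadicInt.unitCoeff_spec hx, Units.val_pow_eq_pow_val, hval, pow_mul', ← mul_pow,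
      ← PadicInt.unitCoeff_spec hR0, hRn]
  exact Units.ext (mul_right_cancel₀ hℓ0 key)

/-- **Residue form**: `x = r^n` in `ℚ_ℓ` (`x ∈ ℤ_ℓ ∖ 0`, `0 < n`) ⇒ the residue `ū_x ∈ 𝔽_ℓˣ` of the unit part
of `x` is an `n`-th power, `ū_x ∈ (𝔽_ℓˣ)^n`. [folklore] -/
theorem unitCoeff_residue_mem_range_powMonoidHom_of_pow_eq {ℓ : ℕ} [Fact ℓ.Prime] {x : ℤ_[ℓ]}
    (hx : x ≠ 0) {n : ℕ} (hn : 0 < n) {r : ℚ_[ℓ]} (hr : r ^ n = x) :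
    Units.map (PadicInt.toZMod (p := ℓ)).toMonoidHom (PadicInt.unitCoeff hx) ∈
      (powMonoidHom n : (ZMod ℓ)ˣ →* (ZMod ℓ)ˣ).range := by
  obtain ⟨u, hu⟩ := exists_unitCoeff_eq_pow_of_pow_eq hx hn hr
  exact ⟨Units.map (PadicInt.toZMod (p := ℓ)).toMonoidHom u, by rw [powMonoidHom_apply, ← map_pow, hu]⟩

/-- **`ū_ℓ ∈ (𝔽_ℓˣ)^p` on `Irr ∧ ¬Surj`**: for `E[p]` irreducible with `ρ̄_{E,p}` not onto, at every split
multiplicative `ℓ` (a Tate datum `D`, `x ∈ ℤ_ℓ` its period) the residue of the unit part of the Tate period is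
a `p`-th power in `𝔽_ℓˣ` — `ρ̄_{E,p}(Frob_ℓ)` acts trivially on `E[p]/μ_p`, the tame Mazur–Tate regulator
entry `λ_R(ū_ℓ)` vanishes mod `p`. [cite: Serre1972, §2.4 Prop. 15] [cite: SilvermanATAEC1994, Prop. V.6.1] -/
theorem unitCoeff_residue_mem_range_powMonoidHom_of_irr_of_not_surj (hirr : Irr W p) (hns : ¬ Surj W p)
    (ℓ : ℕ) [Fact ℓ.Prime] (D : TateParameterData W ℓ) {x : ℤ_[ℓ]} (hx : x ≠ 0)
    (hxq : (x : ℚ_[ℓ]) = D.q) :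
    Units.map (PadicInt.toZMod (p := ℓ)).toMonoidHom (PadicInt.unitCoeff hx) ∈
      (powMonoidHom p : (ZMod ℓ)ˣ →* (ZMod ℓ)ˣ).range := by
  obtain ⟨r, hr⟩ := exists_pow_eq_tateParameterData_q_of_irr_of_not_surj W p hirr hns ℓ D
  exact unitCoeff_residue_mem_range_powMonoidHom_of_pow_eq hx hp.out.pos (hr.trans hxq.symm)

/-- **`ū_ℓ ∈ (𝔽_ℓˣ)^p` on U5's cells** (`ClassX11a W p ∧ ¬ Surj W p`), at every split multiplicative `ℓ`.
[cite: Serre1972, §2.4 Prop. 15] [cite: SilvermanATAEC1994, Prop. V.6.1] -/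
theorem unitCoeff_residue_mem_range_powMonoidHom_of_classX11a_of_not_surj [W.IsGloballyMinimal]
    (hX : ClassX11a W p) (hns : ¬ Surj W p) (ℓ : ℕ) [Fact ℓ.Prime] (D : TateParameterData W ℓ)
    {x : ℤ_[ℓ]} (hx : x ≠ 0) (hxq : (x : ℚ_[ℓ]) = D.q) :
    Units.map (PadicInt.toZMod (p := ℓ)).toMonoidHom (PadicInt.unitCoeff hx) ∈
      (powMonoidHom p : (ZMod ℓ)ˣ →* (ZMod ℓ)ˣ).range :=
  unitCoeff_residue_mem_range_powMonoidHom_of_irr_of_not_surj W p hX.2.2.2.1 hns ℓ D hx hxq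

/-- **`TameMT.TameInstrumentVacuous` HOLDS** — the typed barrier statement of
`Cruxes/UpperNonSurjFive/TameInstrumentVacuous.lean`, binders verbatim, `def`s unfolded (`x : ℤ_[ℓ]` with
`↑x = D.q` for `qInt D`, `Units.map toZMod (unitCoeff hx)` for `tateUnitResidue D`; the Cruxes statement is
`fun W _ _ p ℓ _ _ hX hns h5 hℓp hℓ1 D ↦ tameInstrumentVacuous_unfolded … D (qInt D) (qInt_ne_zero D) rfl`);
the side conditions `5 ≤ p`, `ℓ ≠ p`, `ℓ % p = 1` are not used.
[cite: Serre1972, §2.4 Prop. 15] [cite: SilvermanATAEC1994, Prop. V.6.1] -/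
theorem tameInstrumentVacuous_unfolded :
    ∀ (W : WeierstrassCurve ℚ) [W.IsElliptic] [W.IsGloballyMinimal] (p ℓ : ℕ) [Fact p.Prime] [Fact ℓ.Prime],
      ClassX11a W p → ¬ Surj W p → 5 ≤ p → ℓ ≠ p → ℓ % p = 1 →
        ∀ (D : TateParameterData W ℓ) (x : ℤ_[ℓ]) (hx : x ≠ 0), (x : ℚ_[ℓ]) = D.q →
          Units.map (PadicInt.toZMod (p := ℓ)).toMonoidHom (PadicInt.unitCoeff hx) ∈
            (powMonoidHom p : (ZMod ℓ)ˣ →* (ZMod ℓ)ˣ).range := by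
  intro W _ _ p ℓ _ _ hX hns _ _ _ D x hx hxq
  exact unitCoeff_residue_mem_range_powMonoidHom_of_classX11a_of_not_surj W p hX hns ℓ D hx hxq

/-- **Negative knowledge, `¬ ∃` form**: there is NO globally minimal `E/ℚ`, prime `p`, prime `ℓ` and Tate
datum `D` at `ℓ` (`x ∈ ℤ_ℓ` its period) with `ClassX11a W p`, `¬ Surj W p` and `ū_ℓ ∉ (𝔽_ℓˣ)^p` — the bundle under
which the tame Mazur–Tate regulator entry at `ℓ` could pay Tamagawa depth on U5 is uninhabited.
[cite: Serre1972, §2.4 Prop. 15] [cite: SilvermanATAEC1994, Prop. V.6.1] -/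
theorem not_exists_tame_antecedents :
    ¬ ∃ (W : WeierstrassCurve ℚ) (_ : W.IsElliptic) (_ : W.IsGloballyMinimal) (p ℓ : ℕ) (_ : Fact p.Prime)
        (_ : Fact ℓ.Prime) (D : TateParameterData W ℓ) (x : ℤ_[ℓ]) (hx : x ≠ 0),
        ClassX11a W p ∧ ¬ Surj W p ∧ (x : ℚ_[ℓ]) = D.q ∧
          Units.map (PadicInt.toZMod (p := ℓ)).toMonoidHom (PadicInt.unitCoeff hx) ∉
            (powMonoidHom p : (ZMod ℓ)ˣ →* (ZMod ℓ)ˣ).range := by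
  rintro ⟨W, _, _, p, ℓ, _, _, D, x, hx, hX, hns, hxq, hmem⟩
  exact hmem (unitCoeff_residue_mem_range_powMonoidHom_of_classX11a_of_not_surj W p hX hns ℓ D hx hxq)

end Summit.BirchSwinnertonDyer.BirchSwinnertonDyer.Theorems.UpperNonSurjFive.Negative

end
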